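import Summits.HubbardSuperconductivity.HubbardSuperconductivity.Theses.CooperPairDMottWalk
import Literature.MathematicalPhysics.QuantumLattice.PairFieldEvenSideLRO

/-!
# Route `CooperPairDMottWalk`, crux `DiluteBECBridge` (stmt-HubbardSuperconductivity-10314): the composition of line `birth`

The crux `DiluteBECBridge` (shared verbatim with route `HyperoctahedralMott`) says: for every
`U ∈ [2, 8]`, an `L`-uniform pure-model Cooper pair of two doped holes (clauses (a) binding,
(b) unique two-hole ground state, (c) macroscopic `d_{x²-y²}` pair amplitude, on the sides `4k+4`)
implies, at SOME hole doping `δ ∈ (0, 1/2)`, `d_{x²-y²}` pair-field long-range order of every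
sequence of normalised `(N_L, S^z = 0)`-sector ground states of `hubbardTorus 2 L 1 U`,
`N_L = 2⌊(1-δ)L²/2⌋`, along the even sides (the summit's body at fixed `(U, δ)`).

Line `birth` (tree `Cruxes/DiluteBECBridge/Lines/birth.lean`) splits it as
(R) `PairGapPersists` — the two-hole binding persists as an `L`-uniform odd–even pairing gap on a
dilute doping window — and (B) `DilutePairCondensation` — given that gap, the volume-order pair-field
floor `c·L⁴ ≤ re ⟨ψ, Δ_d† Δ_d ψ⟩` for every normalised `(N_L, 0)` ground state at large even `L`.
This file lands the SORRY-FREE part of that skeleton, so that the reduction "crux ⇐ R ∧ B" is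
importable by whoever closes the stubs:

* `birth_norm_sq_star_dotProduct_mulVec_le` — Cauchy–Schwarz `|⟨φ, A v⟩|² ≤ re ⟨v, Aᴴ A v⟩` for a
  unit vector `φ` of a fermionic Fock space;
* `birth_volumeOrder_of_towerForm` — the planner's Anderson-tower form of (B) (a normalised ground
  state `φ` of `(N_L - 2, 0)` with `c·L⁴ ≤ |⟨φ, Δ_d ψ⟩|²`) implies the registered volume-order form;
* `diluteBECBridge_of_pairGap_of_condensation` — **R → B → `DiluteBECBridge`**, concluded BY NAME:
  `δ := min δ₀ δ₁`; (R) at `δ` gives the gap, (B) the floor; `sum_pairFieldCorr_succ` turns the floor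
  into `c (n+1)⁴ ≤ Σ_{x,y} G_{n+1}(x,y)` and `hasLongRangeOrder_even_of_le` into the summit-format
  `HasLongRangeOrder` along `k ↦ 2k`.

The two stubs themselves are NOT proved here (both are guarded by the unproved pure-model Cooper
pair `CP(U)`; (B) contains `T = 0` Bose–Einstein condensation of a dilute two-dimensional lattice
gas off the half-filled reflection-positivity point, open in print: Kennedy–Lieb–Shastry 1988,
Aizenman–Lieb–Seiringer–Solovej–Yngvason 2004). No definition and no named fact is introduced.

References: D. J. Scalapino, Phys. Rep. 250 (1995) 329, §2 eq. (2.4); C. N. Yang, Rev. Mod. Phys.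
34 (1962) 694, §4; S. Friedli, Y. Velenik, *Statistical Mechanics of Lattice Systems* (2017),
§3.7.2.
-/

set_option linter.dupNamespace false

namespace Summit.HubbardSuperconductivity.HubbardSuperconductivity.Theorems.CooperPairDMottWalk

open scoped Matrix ComplexOrder
open Literature.MathematicalPhysics.QuantumLattice Literature.Probability.LatticeModels
open Summit.HubbardSuperconductivity.HubbardSuperconductivity.Theses.CooperPairDMottWalk

/-- Cauchy–Schwarz in the form the tower-to-volume-order reduction of line `birth` needs: for a
unit vector `φ` of the Fock space, `|⟨φ, A v⟩|² ≤ ‖A v‖² = re ⟨v, Aᴴ A v⟩`. [folklore] -/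
theorem birth_norm_sq_star_dotProduct_mulVec_le {ι : Type*} [LinearOrder ι] [Fintype ι]
    (A : Matrix (Finset ι) (Finset ι) ℂ) (φ v : Fock ι) (hφ : star φ ⬝ᵥ φ = 1) :
    ‖star φ ⬝ᵥ (A *ᵥ v)‖ ^ 2 ≤ (expect (Aᴴ * A) v).re := by
  have hexp : expect (Aᴴ * A) v = star (A *ᵥ v) ⬝ᵥ (A *ᵥ v) := by
    unfold expect
    rw [← Matrix.mulVec_mulVec, Matrix.dotProduct_mulVec, Matrix.vecMul_conjTranspose, star_star]
  rw [hexp, ← norm_toLp_sq_eq_re]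
  have hφsq : ‖(WithLp.toLp 2 φ : EuclideanSpace ℂ (Finset ι))‖ ^ 2 = 1 := by
    rw [norm_toLp_sq_eq_re, hφ, Complex.one_re]
  have hφ0 : 0 ≤ ‖(WithLp.toLp 2 φ : EuclideanSpace ℂ (Finset ι))‖ := norm_nonneg _
  have hφ1 : ‖(WithLp.toLp 2 φ : EuclideanSpace ℂ (Finset ι))‖ = 1 := by
    nlinarith [hφsq, hφ0]
  have hCS := norm_inner_le_norm (𝕜 := ℂ) (WithLp.toLp 2 φ : EuclideanSpace ℂ (Finset ι))
    (WithLp.toLp 2 (A *ᵥ v) : EuclideanSpace ℂ (Finset ι))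
  rw [← star_dotProduct_eq_inner, hφ1, one_mul] at hCS
  have h0 : 0 ≤ ‖star φ ⬝ᵥ (A *ᵥ v)‖ := norm_nonneg _
  have h1 : 0 ≤ ‖(WithLp.toLp 2 (A *ᵥ v) : EuclideanSpace ℂ (Finset ι))‖ := norm_nonneg _
  nlinarith [hCS, h0, h1]

/-- **The Anderson-tower form of stub B implies its registered volume-order form** (line `birth`,
at every `(U, δ)`, same constant `c` and threshold `L₁`): if every normalised ground state `ψ` of
`(N_L, 0)` has a normalised ground state `φ` of `(N_L - 2, 0)` with `c·L⁴ ≤ |⟨φ, Δ_d ψ⟩|²`, then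
`c·L⁴ ≤ re ⟨ψ, Δ_d† Δ_d ψ⟩` (`birth_norm_sq_star_dotProduct_mulVec_le`). The converse fails in
general (selection rules between the two ground multiplets). [folklore] -/
theorem birth_volumeOrder_of_towerForm (U δ : ℝ) :
    (∃ c > (0 : ℝ), ∃ L₁ : ℕ, ∀ (L : ℕ) [NeZero L], L₁ ≤ L → Even L →
        ∀ ψ : Fock (Orb (FermionTorus 2 L)), star ψ ⬝ᵥ ψ = 1 →
          IsGroundStateInSector (hubbardTorus 2 L 1 U) (2 * ⌊(1 - δ) * (L : ℝ) ^ 2 / 2⌋₊) 0 ψ →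
            ∃ φ : Fock (Orb (FermionTorus 2 L)), star φ ⬝ᵥ φ = 1 ∧
              IsGroundStateInSector (hubbardTorus 2 L 1 U)
                  (2 * ⌊(1 - δ) * (L : ℝ) ^ 2 / 2⌋₊ - 2) 0 φ ∧
                c * (L : ℝ) ^ 4 ≤ ‖star φ ⬝ᵥ (pairField dWaveFormFactor L *ᵥ ψ)‖ ^ 2) →
    ∃ c > (0 : ℝ), ∃ L₁ : ℕ, ∀ (L : ℕ) [NeZero L], L₁ ≤ L → Even L →
        ∀ ψ : Fock (Orb (FermionTorus 2 L)), star ψ ⬝ᵥ ψ = 1 →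
          IsGroundStateInSector (hubbardTorus 2 L 1 U) (2 * ⌊(1 - δ) * (L : ℝ) ^ 2 / 2⌋₊) 0 ψ →
            c * (L : ℝ) ^ 4 ≤
              (expect ((pairField dWaveFormFactor L)ᴴ * pairField dWaveFormFactor L) ψ).re := by
  rintro ⟨c, hc, L₁, hL⟩
  refine ⟨c, hc, L₁, fun L _ hKL hL2 ψ hnorm hGS => ?_⟩
  obtain ⟨φ, hφ, -, hamp⟩ := hL L hKL hL2 ψ hnorm hGS
  exact hamp.trans (birth_norm_sq_star_dotProduct_mulVec_le (pairField dWaveFormFactor L) φ ψ hφ)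

/-- **Line `birth`: R → B → `DiluteBECBridge`, concluded BY NAME.** Hypothesis R
(`stub_pairGapPersists` of the registered skeleton): for every `U ∈ [2,8]` with a pure Cooper pair
there is `δ₀ ∈ (0, 1/2)` such that at every `δ ∈ (0, δ₀]` the odd–even pairing gap
`E_L(N_L-2,0) + E_L(N_L,0) + ε' ≤ 2E_L(N_L-1,½)` holds uniformly in large even `L`. Hypothesis B
(`stub_dilutePairCondensation`): for every such `U` there is `δ₁ ∈ (0, 1/2)` such that at every
`δ ∈ (0, δ₁]` where that gap holds, `c·L⁴ ≤ re ⟨ψ, Δ_d† Δ_d ψ⟩` for every normalised `(N_L, 0)`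
ground state `ψ`, large even `L`. Proof: `δ := min δ₀ δ₁`; R at `δ` feeds B; for a summit sequence
`(N, ψ)` at `(U, δ)` and an even side `n + 1 ≥ L₁` the floor is `c (n+1)⁴ ≤ Σ_{x,y} G_{n+1}(x,y)`
(`sum_pairFieldCorr_succ`), and `hasLongRangeOrder_even_of_le` gives the even-side long-range order
of the summit format. [cite: Scalapino1995, §2 eq. (2.4)] -/
theorem diluteBECBridge_of_pairGap_of_condensation :
    (let CP := fun (L : ℕ) [NeZero L]
        (H : Matrix (Finset (Orb (FermionTorus 2 L))) (Finset (Orb (FermionTorus 2 L))) ℂ)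
        (ε z : ℝ) =>
      H.minEnergyOn (szSector (L ^ 2 - 2) 0) + H.minEnergyOn (szSector (L ^ 2) 0) + ε ≤
          2 * H.minEnergyOn (szSector (L ^ 2 - 1) (1 / 2)) ∧
        (∀ φ₁ φ₂, IsGroundStateInSector H (L ^ 2 - 2) 0 φ₁ →
          IsGroundStateInSector H (L ^ 2 - 2) 0 φ₂ → ∃ c : ℂ, φ₂ = c • φ₁) ∧
        (∀ φ₀ φ₂, IsGroundStateInSector H (L ^ 2) 0 φ₀ →
          IsGroundStateInSector H (L ^ 2 - 2) 0 φ₂ →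
            z * (L : ℝ) ^ 2 * (star φ₀ ⬝ᵥ φ₀).re * (star φ₂ ⬝ᵥ φ₂).re ≤
              ‖star φ₂ ⬝ᵥ (pairField dWaveFormFactor L *ᵥ φ₀)‖ ^ 2);
    let PG := fun (U δ : ℝ) =>
      ∃ ε' > (0 : ℝ), ∃ L₁ : ℕ, ∀ L : ℕ, L₁ ≤ L → Even L →
        (hubbardTorus 2 L 1 U).minEnergyOn (szSector (2 * ⌊(1 - δ) * (L : ℝ) ^ 2 / 2⌋₊ - 2) 0) +
              (hubbardTorus 2 L 1 U).minEnergyOn (szSector (2 * ⌊(1 - δ) * (L : ℝ) ^ 2 / 2⌋₊) 0) +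
            ε' ≤
          2 * (hubbardTorus 2 L 1 U).minEnergyOn
            (szSector (2 * ⌊(1 - δ) * (L : ℝ) ^ 2 / 2⌋₊ - 1) (1 / 2));
    ∀ U ∈ Set.Icc (2 : ℝ) 8,
      (∃ ε > (0 : ℝ), ∃ z > (0 : ℝ), ∃ k₀ : ℕ, ∀ k ≥ k₀,
          CP (4 * k + 4) (hubbardTorus 2 (4 * k + 4) 1 U) ε z) →
        ∃ δ₀ ∈ Set.Ioo (0 : ℝ) (1 / 2), ∀ δ ∈ Set.Ioc (0 : ℝ) δ₀, PG U δ) →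
    (let CP := fun (L : ℕ) [NeZero L]
        (H : Matrix (Finset (Orb (FermionTorus 2 L))) (Finset (Orb (FermionTorus 2 L))) ℂ)
        (ε z : ℝ) =>
      H.minEnergyOn (szSector (L ^ 2 - 2) 0) + H.minEnergyOn (szSector (L ^ 2) 0) + ε ≤
          2 * H.minEnergyOn (szSector (L ^ 2 - 1) (1 / 2)) ∧
        (∀ φ₁ φ₂, IsGroundStateInSector H (L ^ 2 - 2) 0 φ₁ →
          IsGroundStateInSector H (L ^ 2 - 2) 0 φ₂ → ∃ c : ℂ, φ₂ = c • φ₁) ∧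
        (∀ φ₀ φ₂, IsGroundStateInSector H (L ^ 2) 0 φ₀ →
          IsGroundStateInSector H (L ^ 2 - 2) 0 φ₂ →
            z * (L : ℝ) ^ 2 * (star φ₀ ⬝ᵥ φ₀).re * (star φ₂ ⬝ᵥ φ₂).re ≤
              ‖star φ₂ ⬝ᵥ (pairField dWaveFormFactor L *ᵥ φ₀)‖ ^ 2);
    let PG := fun (U δ : ℝ) =>
      ∃ ε' > (0 : ℝ), ∃ L₁ : ℕ, ∀ L : ℕ, L₁ ≤ L → Even L →
        (hubbardTorus 2 L 1 U).minEnergyOn (szSector (2 * ⌊(1 - δ) * (L : ℝ) ^ 2 / 2⌋₊ - 2) 0) +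
              (hubbardTorus 2 L 1 U).minEnergyOn (szSector (2 * ⌊(1 - δ) * (L : ℝ) ^ 2 / 2⌋₊) 0) +
            ε' ≤
          2 * (hubbardTorus 2 L 1 U).minEnergyOn
            (szSector (2 * ⌊(1 - δ) * (L : ℝ) ^ 2 / 2⌋₊ - 1) (1 / 2));
    let VO := fun (U δ : ℝ) =>
      ∃ c > (0 : ℝ), ∃ L₁ : ℕ, ∀ (L : ℕ) [NeZero L], L₁ ≤ L → Even L →
        ∀ ψ : Fock (Orb (FermionTorus 2 L)), star ψ ⬝ᵥ ψ = 1 →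
          IsGroundStateInSector (hubbardTorus 2 L 1 U) (2 * ⌊(1 - δ) * (L : ℝ) ^ 2 / 2⌋₊) 0 ψ →
            c * (L : ℝ) ^ 4 ≤
              (expect ((pairField dWaveFormFactor L)ᴴ * pairField dWaveFormFactor L) ψ).re;
    ∀ U ∈ Set.Icc (2 : ℝ) 8,
      (∃ ε > (0 : ℝ), ∃ z > (0 : ℝ), ∃ k₀ : ℕ, ∀ k ≥ k₀,
          CP (4 * k + 4) (hubbardTorus 2 (4 * k + 4) 1 U) ε z) →
        ∃ δ₁ ∈ Set.Ioo (0 : ℝ) (1 / 2), ∀ δ ∈ Set.Ioc (0 : ℝ) δ₁, PG U δ → VO U δ) →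
    DiluteBECBridge := by
  intro hR hB
  dsimp only at hR
  dsimp only at hB
  dsimp only [DiluteBECBridge]
  intro U hU hCP
  obtain ⟨δ₀, hδ₀, hPG⟩ := hR U hU hCP
  obtain ⟨δ₁, hδ₁, hVO⟩ := hB U hU hCP
  have hδpos : 0 < min δ₀ δ₁ := lt_min hδ₀.1 hδ₁.1
  have hδhalf : min δ₀ δ₁ < 1 / 2 := lt_of_le_of_lt (min_le_left δ₀ δ₁) hδ₀.2
  refine ⟨min δ₀ δ₁, ⟨hδpos, hδhalf⟩, ?_⟩
  intro N ψ hNψ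
  -- the pairing gap at `δ` (hypothesis R) and the volume-order pair-field bound (hypothesis B)
  have hgap := hPG (min δ₀ δ₁) ⟨hδpos, min_le_left δ₀ δ₁⟩
  obtain ⟨c, hc, L₁, hL⟩ := hVO (min δ₀ δ₁) ⟨hδpos, min_le_right δ₀ δ₁⟩ hgap
  -- even-side long-range order from the volume-order lower bound `c (n+1)⁴ ≤ Σ_{x,y} G`
  refine hasLongRangeOrder_even_of_le dWaveFormFactor ψ (fun n hn => (hNψ (n + 1) hn).2.1) hc L₁
    ?_
  intro n hn hKn
  obtain ⟨hN, hnorm, hGS⟩ := hNψ (n + 1) hn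
  rw [hN] at hGS
  rw [sum_pairFieldCorr_succ]
  exact hL (n + 1) hKn hn (ψ (n + 1)) hnorm hGS

end Summit.HubbardSuperconductivity.HubbardSuperconductivity.Theorems.CooperPairDMottWalk
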